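import Summits.NavierStokesRegularity.NavierStokesRegularity.Theses.AxisymmetricExtremality
import Summits.NavierStokesRegularity.NavierStokesRegularity.Theorems.AxisymmetricExtremalityAxisymmetricKatoGlobalStubSeregin2020TypeIILemma22EnergySlice
import HarnessLib

/-!
# Seregin 2020, Lemma 2.2 (after Nazarov–Uraltseva 2012): the very weak form of the
# supersolution inequality `∂ₜΦ + (U + 2x'/|x'|²)·∇Φ - ΔΦ ≥ 0` for test functions supported
# OFF the axis

Helper toward the stub `stub_seregin2020TypeII` of the crux `AxisymmetricKatoGlobal` (= the named
fact `Literature.Analysis.FluidPDE.Seregin2020_axisymmetricSingularPoint_typeII`, G. Seregin,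
Anal. Math. Phys. 10 (2020) Paper 46 = arXiv:2006.04140, Thm 2.1), reduced this session to
Lemma 2.2 of the paper in the corrected rendering `hWH′` (SUPERsolutions of (2.12)). The printed
proof of Lemma 2.2 starts (arXiv p. 8) from "the inequality
`∫ (∂ₜπ η + ∇π·∇η - (u + 2x'/|x'|²)·∇η π) dx dt ≥ 4π₀ ∫ π η dx₃ dt`
for any test function `η` being equal to zero near spatial boundary" — Nazarov–Uraltseva's (4.5),
the very weak form of `∂ₜπ + b·∇π - Δπ ≥ 0` in which the distributional divergence
`div(2x'/|x'|²) = 4π₀ δ_{axis}` produces the axis term. Its derivation integrates the pointwise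
inequality against `η ≥ 0` with the axis cut off at distance `ε` and lets `ε → 0`. This file is
the `ε`-level statement: the very weak form for test functions `χ ≥ 0` supported off the axis,
where `Φ` is classical (piece P5a of the session frontier):

* `integral_mul_timeDeriv_slice_eq_neg` — integration by parts in time inside space–time
  integrals, `∫∫ g ∂ₜχ = -∫∫ (∂ₜg) χ`, for `g` continuous with a classical, jointly continuous
  `∂ₜg` on an open set carrying the test function `χ` (Fubini and the one-dimensional
  integration by parts on every time line; twin of the tree's spatial
  `SereginZajaczkowski2007.integral_mul_fderiv_slice_eq_neg`);
* `integral_eq_zero_of_forall_slice` — a space–time integral vanishes when all its time slices do;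
* `veryWeak_supersolution_offAxis` — for `V` open and off the axis, `Φ` continuous on `V` with
  `C²` slices, `∇Φ`, `ΔΦ`, `∂ₜΦ` jointly continuous, a drift `U` continuous with `C¹`
  divergence-free slices, `0 ≤ ∂ₜΦ + DΦ[U] + (2/ϱ)∂_ϱΦ - ΔΦ` on `V`, and a test function
  `χ ≥ 0` on `V`:
  `0 ≤ -∫∫ Φ ∂ₜχ - ∫∫ Φ Dχ[U] - ∫∫ Φ (2/ϱ)∂_ϱχ - ∫∫ (ΔΦ) χ`
  (time derivative and both drifts moved onto `χ` — `div U = 0`, `div(2x'/|x'|²) = 0` off the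
  axis —, the Laplacian kept on `Φ`: this is the form whose `ε → 0` limit is taken in the
  sibling `…Lemma22VeryWeakAxis`).

## References

* G. Seregin, Anal. Math. Phys. 10 (2020), Paper 46 = arXiv:2006.04140, proof of Lemma 2.2
  (arXiv p. 8), the displayed inequality. [Seregin2020]
* A. I. Nazarov, N. N. Uraltseva, St. Petersburg Math. J. 23 (2012) 93–115 = arXiv:1011.1888,
  §4, (4.3) `div b = 4πεδ_Γ` and (4.5). [NazarovUraltseva2012]
-/

-- the problem directory repeats the summit name (D-0017); core's `dupNamespace` linter fires
set_option linter.dupNamespace false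

noncomputable section

open MeasureTheory Set Function Filter Topology TopologicalSpace Metric WithLp
open scoped NNReal ENNReal InnerProductSpace RealInnerProductSpace Laplacian

namespace Summit.NavierStokesRegularity.NavierStokesRegularity.Theorems.AxisymmetricKatoGlobal.EulerScaling

open Literature.Analysis.FluidPDE Literature.Analysis.FluidPDE.Seregin2020
  Literature.Analysis.FluidPDE.SereginZajaczkowski2007

/-! ### Integration by parts in time inside space–time integrals -/

/-- **Integration by parts in time, slice by slice.** Let `U ⊆ ℝ × ℝ³` be open, `g : ℝ × ℝ³ → ℝ`
continuous on `U`, differentiable in `t` at the points of `U` with `(t, x) ↦ ∂ₜg(t, x)`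
continuous on `U`, and let `χ` be a space–time test function on `U`. Then
`∫∫ g ∂ₜχ dx dt = -∫∫ (∂ₜg) χ dx dt` (integrals over `ℝ × ℝ³`): Fubini with the time integral
inside, and on each time line Mathlib's `integral_mul_fderiv_eq_neg_fderiv_mul_of_integrable`,
which needs differentiability of `g(·, x)` only on the support of `χ(·, x)`. No regularity of `g`
in `x` is used. [folklore] -/
theorem integral_mul_timeDeriv_slice_eq_neg {U : Opens (ℝ × EuclideanSpace ℝ (Fin 3))}
    {g : ℝ × EuclideanSpace ℝ (Fin 3) → ℝ} {χ : ℝ → EuclideanSpace ℝ (Fin 3) → ℝ}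
    (hg0 : ContinuousOn g (U : Set (ℝ × EuclideanSpace ℝ (Fin 3))))
    (hgd : ∀ z ∈ (U : Set (ℝ × EuclideanSpace ℝ (Fin 3))), DifferentiableAt ℝ (fun s => g (s, z.2)) z.1)
    (hg1 : ContinuousOn (fun z : ℝ × EuclideanSpace ℝ (Fin 3) => deriv (fun s => g (s, z.2)) z.1)
      (U : Set (ℝ × EuclideanSpace ℝ (Fin 3))))
    (hχ : IsSpaceTimeTestOn U χ) :
    ∫ z : ℝ × EuclideanSpace ℝ (Fin 3), g z * timeDeriv χ z.1 z.2 =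
      -∫ z : ℝ × EuclideanSpace ℝ (Fin 3), deriv (fun s => g (s, z.2)) z.1 * χ z.1 z.2 := by
  -- the two space–time integrands are integrable
  set A : ℝ × EuclideanSpace ℝ (Fin 3) → ℝ := fun z => g z * timeDeriv χ z.1 z.2 with hA
  set B : ℝ × EuclideanSpace ℝ (Fin 3) → ℝ := fun z => χ z.1 z.2 * deriv (fun s => g (s, z.2)) z.1 with hB
  have hAi : Integrable A := integrable_mul_timeDeriv hg0 hχ
  have hBi : Integrable B := integrable_test_mul hg1 hχ
  have hFubA : ∫ z, A z = ∫ x, ∫ t, A (t, x) := by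
    rw [Measure.volume_eq_prod]
    exact integral_prod_symm A ((Measure.volume_eq_prod (ℝ) (EuclideanSpace ℝ (Fin 3))) ▸ hAi)
  have hFubB : ∫ z, B z = ∫ x, ∫ t, B (t, x) := by
    rw [Measure.volume_eq_prod]
    exact integral_prod_symm B ((Measure.volume_eq_prod (ℝ) (EuclideanSpace ℝ (Fin 3))) ▸ hBi)
  -- the compact time shadow of the support of `χ`
  set K : Set (ℝ × EuclideanSpace ℝ (Fin 3)) := tsupport (uncurry χ) with hK
  have hKc : IsCompact K := hχ.hasCompactSupport
  have hKU : K ⊆ (U : Set (ℝ × EuclideanSpace ℝ (Fin 3))) := hχ.tsupport_subset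
  set T : Set ℝ := Prod.fst '' K with hT
  have hTc : IsCompact T := hKc.image continuous_fst
  -- time line by time line
  have hline : ∀ x : EuclideanSpace ℝ (Fin 3), ∫ t, A (t, x) = -∫ t, B (t, x) := by
    intro x
    set Ux : Set ℝ := {s | (s, x) ∈ (U : Set (ℝ × EuclideanSpace ℝ (Fin 3)))} with hUx_def
    have hmk : Continuous fun s : ℝ => ((s, x) : ℝ × EuclideanSpace ℝ (Fin 3)) := continuous_id.prodMk continuous_const
    have hUx : IsOpen Ux := U.isOpen.preimage hmk
    -- the time line of the test function
    set φ : ℝ → ℝ := fun s => χ s x with hφ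
    have hφC : ContDiff ℝ 1 φ := (hχ.contDiff.of_le (by simp)).comp (contDiff_id.prodMk contDiff_const)
    have hφc : Continuous φ := hφC.continuous
    have hφd : Differentiable ℝ φ := hφC.differentiable one_ne_zero
    have hsuppφ : support φ ⊆ (fun s => ((s, x) : ℝ × EuclideanSpace ℝ (Fin 3))) ⁻¹' K := fun s hs =>
      subset_tsupport _ (by simpa [hφ] using hs)
    have htsφ : tsupport φ ⊆ (fun s => ((s, x) : ℝ × EuclideanSpace ℝ (Fin 3))) ⁻¹' K :=
      closure_minimal hsuppφ ((isClosed_tsupport _).preimage hmk)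
    have hφK : HasCompactSupport φ := by
      refine IsCompact.of_isClosed_subset hTc (isClosed_tsupport _) fun s hs => ?_
      exact ⟨(s, x), htsφ hs, rfl⟩
    have hφU : tsupport φ ⊆ Ux := fun s hs => hKU (htsφ hs)
    -- its time derivative
    set φ' : ℝ → ℝ := fun s => timeDeriv χ s x with hφ'
    have hφ'e : ∀ s, fderiv ℝ φ s 1 = φ' s := fun s => by
      show fderiv ℝ φ s 1 = timeDeriv χ s x
      rw [timeDeriv_apply, fderiv_apply_one_eq_deriv]
    have hφ'c : Continuous φ' := hχ.continuous_timeDeriv.comp hmk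
    have hsuppφ' : support φ' ⊆ (fun s => ((s, x) : ℝ × EuclideanSpace ℝ (Fin 3))) ⁻¹' K := fun s hs => by
      by_contra h
      exact hs (timeDeriv_eq_zero_off_tsupport h)
    have htsφ' : tsupport φ' ⊆ (fun s => ((s, x) : ℝ × EuclideanSpace ℝ (Fin 3))) ⁻¹' K :=
      closure_minimal hsuppφ' ((isClosed_tsupport _).preimage hmk)
    have hφ'K : HasCompactSupport φ' := by
      refine IsCompact.of_isClosed_subset hTc (isClosed_tsupport _) fun s hs => ?_
      exact ⟨(s, x), htsφ' hs, rfl⟩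
    have hφ'U : tsupport φ' ⊆ Ux := fun s hs => hKU (htsφ' hs)
    -- the time line of `g`
    set f : ℝ → ℝ := fun s => g (s, x) with hf
    have hfc : ContinuousOn f Ux := hg0.comp hmk.continuousOn fun s hs => hs
    have hf'c : ContinuousOn (fun s => deriv f s) Ux := hg1.comp hmk.continuousOn fun s hs => hs
    have hf'c1 : ContinuousOn (fun s => fderiv ℝ f s 1) Ux := hf'c.congr fun s _ => fderiv_apply_one_eq_deriv
    have hfd : ∀ s ∈ Ux, DifferentiableAt ℝ f s := fun s hs => hgd (s, x) hs
    -- integrability of the three products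
    have i1 : Integrable (fun s => fderiv ℝ f s 1 * φ s) := by
      have h : Integrable (fun s => φ s * fderiv ℝ f s 1) :=
        (continuous_mul_of_tsupport_subset' hUx hφc hφU hf'c1).integrable_of_hasCompactSupport hφK.mul_right
      exact h.congr (Eventually.of_forall fun s => mul_comm _ _)
    have i2 : Integrable (fun s => f s * fderiv ℝ φ s 1) := by
      have h : Integrable (fun s => φ' s * f s) :=
        (continuous_mul_of_tsupport_subset' hUx hφ'c hφ'U hfc).integrable_of_hasCompactSupport hφ'K.mul_right
      exact h.congr (Eventually.of_forall fun s => by beta_reduce; rw [hφ'e s, mul_comm])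
    have i3 : Integrable (fun s => f s * φ s) := by
      have h : Integrable (fun s => φ s * f s) :=
        (continuous_mul_of_tsupport_subset' hUx hφc hφU hfc).integrable_of_hasCompactSupport hφK.mul_right
      exact h.congr (Eventually.of_forall fun s => mul_comm _ _)
    have ibp := integral_mul_fderiv_eq_neg_fderiv_mul_of_integrable (μ := volume) i1 i2 i3
      (fun s hs => hfd s (hφU hs)) (fun s _ => hφd s)
    have hAt : ∫ t, A (t, x) = ∫ s, f s * fderiv ℝ φ s 1 :=
      integral_congr_ae (Eventually.of_forall fun s => by simp only [hA, hφ'e s, hφ', hf])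
    have hBt : ∫ t, B (t, x) = ∫ s, fderiv ℝ f s 1 * φ s :=
      integral_congr_ae (Eventually.of_forall fun s => by
        simp only [hB, hφ, hf, fderiv_apply_one_eq_deriv]
        exact mul_comm _ _)
    rw [hAt, hBt, ibp]
  calc ∫ z : ℝ × EuclideanSpace ℝ (Fin 3), g z * timeDeriv χ z.1 z.2 = ∫ z, A z := rfl
    _ = ∫ x, ∫ t, A (t, x) := hFubA
    _ = ∫ x, -∫ t, B (t, x) := integral_congr_ae (Eventually.of_forall hline)
    _ = -∫ x, ∫ t, B (t, x) := integral_neg (μ := volume) fun x => ∫ t, B (t, x)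
    _ = -∫ z, B z := by rw [hFubB]
    _ = -∫ z : ℝ × EuclideanSpace ℝ (Fin 3), deriv (fun s => g (s, z.2)) z.1 * χ z.1 z.2 := by
        congr 1
        exact integral_congr_ae (Eventually.of_forall fun z => mul_comm (χ z.1 z.2) _)

/-- A space–time integral of an integrable function vanishes when all its time slices have
vanishing integral (Fubini). [folklore] -/
theorem integral_eq_zero_of_forall_slice {F : ℝ × EuclideanSpace ℝ (Fin 3) → ℝ} (hF : Integrable F)
    (h : ∀ t : ℝ, ∫ x, F (t, x) = 0) : ∫ z, F z = 0 := by
  have hFub : ∫ z, F z = ∫ t, ∫ x, F (t, x) := by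
    rw [Measure.volume_eq_prod]
    exact integral_prod F ((Measure.volume_eq_prod (ℝ) (EuclideanSpace ℝ (Fin 3))) ▸ hF)
  rw [hFub]
  simp [h]

/-! ### Moving a divergence-free drift onto the test function, slice by slice -/

/-- **The drift term moves onto the test function** (slice identity). For `O ⊆ ℝ³` open,
`F ∈ C¹(O)`, a field `X ∈ C¹(O)` with `div X = 0` on `O`, and `θ ∈ C¹_c` with `tsupport θ ⊆ O`:
`∫ (θ DF[X] + F Dθ[X]) dx = 0` (`= ∫ ⟪X, ∇(θF)⟫ = -∫ div X · θF = 0`; the tree's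
`Seregin2020.integral_inner_gradient_eq_zero_of_divergence_eq_zero_of_subset`). [folklore] -/
theorem integral_mul_fderiv_add_mul_fderiv_eq_zero {O : Set (EuclideanSpace ℝ (Fin 3))} (hO : IsOpen O)
    {F : EuclideanSpace ℝ (Fin 3) → ℝ} (hF : ContDiffOn ℝ 1 F O)
    {X : EuclideanSpace ℝ (Fin 3) → EuclideanSpace ℝ (Fin 3)} (hX : ContDiffOn ℝ 1 X O)
    (hdiv : ∀ x ∈ O, VectorCalculus.divergence X x = 0)
    {θ : EuclideanSpace ℝ (Fin 3) → ℝ} (hθ : ContDiff ℝ 1 θ) (hθc : HasCompactSupport θ) (hθO : tsupport θ ⊆ O) :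
    ∫ x, (θ x * fderiv ℝ F x (X x) + F x * fderiv ℝ θ x (X x)) = 0 := by
  set ψ : EuclideanSpace ℝ (Fin 3) → ℝ := fun x => θ x • F x with hψ
  have hψC : ContDiff ℝ 1 ψ := contDiff_cutoff_smul_of_contDiffOn hO hθ hθO hF
  have hψK : tsupport ψ ⊆ tsupport θ := tsupport_smul_subset_left _ _
  have hψc : HasCompactSupport ψ := hθc.of_isClosed_subset (isClosed_tsupport _) hψK
  have hψO : tsupport ψ ⊆ O := hψK.trans hθO
  have hz := integral_inner_gradient_eq_zero_of_divergence_eq_zero_of_subset hO hX hdiv hψC hψc hψO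
  rw [← hz]
  refine integral_congr_ae (ae_of_all _ fun x => ?_)
  beta_reduce
  rw [real_inner_comm, inner_gradient_left]
  by_cases hx : x ∈ tsupport θ
  · have hxO : x ∈ O := hθO hx
    have hFd : DifferentiableAt ℝ F x := (hF.differentiableOn one_ne_zero x hxO).differentiableAt (hO.mem_nhds hxO)
    have hθd : DifferentiableAt ℝ θ x := (hθ.differentiable one_ne_zero) x
    rw [hψ, show (fun x => θ x • F x) = fun x => θ x * F x from rfl, fderiv_fun_mul hθd hFd]
    simp only [_root_.add_apply, FunLike.coe_smul, Pi.smul_apply, smul_eq_mul]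
  · have h0 : fderiv ℝ ψ x = 0 := fderiv_of_notMem_tsupport ℝ fun h => hx (hψK h)
    have hθ0 : θ x = 0 := image_eq_zero_of_notMem_tsupport hx
    have hθ'0 : fderiv ℝ θ x = 0 := fderiv_of_notMem_tsupport ℝ hx
    rw [h0, hθ0, hθ'0]
    simp

/-! ### The very weak form off the axis -/

/-- A function on `ℝ × ℝ³` continuous on an open `V` and vanishing off a compact `K ⊆ V` is
integrable (it is continuous: near points outside `V` it vanishes identically). [folklore] -/
theorem integrable_of_continuousOn_of_eq_zero_off {F : ℝ × EuclideanSpace ℝ (Fin 3) → ℝ}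
    {V K : Set (ℝ × EuclideanSpace ℝ (Fin 3))} (hV : IsOpen V) (hK : IsCompact K) (hKV : K ⊆ V)
    (hF : ContinuousOn F V) (h0 : ∀ z, z ∉ K → F z = 0) : Integrable F := by
  have hc : Continuous F := by
    rw [continuous_iff_continuousAt]
    intro z
    by_cases hz : z ∈ V
    · exact hF.continuousAt (hV.mem_nhds hz)
    · have hzK : z ∉ K := fun h => hz (hKV h)
      have hev : F =ᶠ[𝓝 z] fun _ => 0 := by
        filter_upwards [hK.isClosed.isOpen_compl.mem_nhds hzK] with w hw
        exact h0 w hw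
      exact continuousAt_const.congr hev.symm
  exact hc.integrable_of_hasCompactSupport (HasCompactSupport.intro hK h0)

/-- The slice derivative `(t, x) ↦ D(χ t)(x)` of a space–time test function is continuous.
[folklore] -/
theorem continuous_fderiv_slice {V : Opens (ℝ × EuclideanSpace ℝ (Fin 3))} {χ : ℝ → EuclideanSpace ℝ (Fin 3) → ℝ}
    (hχ : IsSpaceTimeTestOn V χ) : Continuous fun z : ℝ × EuclideanSpace ℝ (Fin 3) => fderiv ℝ (χ z.1) z.2 := by
  have hd := hχ.contDiff.continuous_fderiv (by simp)
  have hslice : ∀ z : ℝ × EuclideanSpace ℝ (Fin 3), fderiv ℝ (χ z.1) z.2 =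
      (fderiv ℝ (uncurry χ) z).comp (ContinuousLinearMap.inr ℝ ℝ (EuclideanSpace ℝ (Fin 3))) := by
    intro z
    have h1 : HasFDerivAt (fun y : EuclideanSpace ℝ (Fin 3) => ((z.1, y) : ℝ × EuclideanSpace ℝ (Fin 3)))
        (ContinuousLinearMap.inr ℝ ℝ (EuclideanSpace ℝ (Fin 3))) z.2 := hasFDerivAt_prodMk_right z.1 z.2
    have h2 := ((hχ.contDiff.differentiable (by simp) (z.1, z.2)).hasFDerivAt).comp z.2 h1
    exact h2.fderiv
  simp_rw [hslice]
  exact ((ContinuousLinearMap.compL ℝ (EuclideanSpace ℝ (Fin 3)) (ℝ × EuclideanSpace ℝ (Fin 3)) ℝ).flip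
    (ContinuousLinearMap.inr ℝ ℝ (EuclideanSpace ℝ (Fin 3)))).continuous.comp hd

/-- **The very weak form of the supersolution inequality, for test functions supported off the
axis** (the `ε`-level form of Seregin's displayed inequality / Nazarov–Uraltseva's (4.5), before
the axis term appears). Let `V ⊆ ℝ × ℝ³` be open and off the axis; `Φ` continuous on `V` with
`C²` slices and `∇Φ`, `ΔΦ`, `∂ₜΦ` (classical) jointly continuous on `V`; `U` continuous on `V`
with `C¹` divergence-free slices; `0 ≤ ∂ₜΦ + DΦ[U] + (2/ϱ)∂_ϱΦ - ΔΦ` on `V`; `χ ≥ 0` a space–time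
test function on `V`. Then
`0 ≤ -∫∫ Φ ∂ₜχ - ∫∫ Φ Dχ[U] - ∫∫ Φ (2/ϱ) ∂_ϱχ - ∫∫ (ΔΦ) χ`
(the pointwise inequality times `χ` integrated; `∂ₜ` by parts in time; the two drifts by parts in
space using `div U = 0` and `div (2x'/|x'|²) = 0` off the axis).
[cite: Seregin2020, proof of Lemma 2.2 (arXiv p. 8), the displayed inequality; NazarovUraltseva2012 (4.5)] -/
theorem veryWeak_supersolution_offAxis : ∀ (V : Opens (ℝ × EuclideanSpace ℝ (Fin 3))),
    (∀ z ∈ (V : Set (ℝ × EuclideanSpace ℝ (Fin 3))), cylRadius z.2 ≠ 0) →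
    ∀ (Φ : ℝ → EuclideanSpace ℝ (Fin 3) → ℝ) (U : ℝ → EuclideanSpace ℝ (Fin 3) → EuclideanSpace ℝ (Fin 3)),
    ContinuousOn (uncurry Φ) (V : Set (ℝ × EuclideanSpace ℝ (Fin 3))) →
    (∀ z ∈ (V : Set (ℝ × EuclideanSpace ℝ (Fin 3))), ContDiffAt ℝ 2 (Φ z.1) z.2) →
    ContinuousOn (fun z : ℝ × EuclideanSpace ℝ (Fin 3) => fderiv ℝ (Φ z.1) z.2) (V : Set (ℝ × EuclideanSpace ℝ (Fin 3))) →
    ContinuousOn (fun z : ℝ × EuclideanSpace ℝ (Fin 3) => Laplacian.laplacian (Φ z.1) z.2) (V : Set (ℝ × EuclideanSpace ℝ (Fin 3))) →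
    (∀ z ∈ (V : Set (ℝ × EuclideanSpace ℝ (Fin 3))), DifferentiableAt ℝ (fun r => Φ r z.2) z.1) →
    ContinuousOn (fun z : ℝ × EuclideanSpace ℝ (Fin 3) => deriv (fun r => Φ r z.2) z.1) (V : Set (ℝ × EuclideanSpace ℝ (Fin 3))) →
    ContinuousOn (uncurry U) (V : Set (ℝ × EuclideanSpace ℝ (Fin 3))) →
    (∀ z ∈ (V : Set (ℝ × EuclideanSpace ℝ (Fin 3))), ContDiffAt ℝ 1 (U z.1) z.2) →
    (∀ z ∈ (V : Set (ℝ × EuclideanSpace ℝ (Fin 3))), VectorCalculus.divergence (U z.1) z.2 = 0) →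
    (∀ z ∈ (V : Set (ℝ × EuclideanSpace ℝ (Fin 3))), 0 ≤ deriv (fun r => Φ r z.2) z.1 + fderiv ℝ (Φ z.1) z.2 (U z.1 z.2) +
      2 / cylRadius z.2 * partialDeriv (eR z.2) (Φ z.1) z.2 - Laplacian.laplacian (Φ z.1) z.2) →
    ∀ (χ : ℝ → EuclideanSpace ℝ (Fin 3) → ℝ), IsSpaceTimeTestOn V χ → (∀ t x, 0 ≤ χ t x) →
    0 ≤ -(∫ z : ℝ × EuclideanSpace ℝ (Fin 3), Φ z.1 z.2 * timeDeriv χ z.1 z.2)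
        - (∫ z : ℝ × EuclideanSpace ℝ (Fin 3), Φ z.1 z.2 * fderiv ℝ (χ z.1) z.2 (U z.1 z.2))
        - (∫ z : ℝ × EuclideanSpace ℝ (Fin 3), Φ z.1 z.2 * (2 / cylRadius z.2 * partialDeriv (eR z.2) (χ z.1) z.2))
        - ∫ z : ℝ × EuclideanSpace ℝ (Fin 3), Laplacian.laplacian (Φ z.1) z.2 * χ z.1 z.2 := by
  intro V hVρ Φ U hΦc hΦs hΦg hΦΔ hΦt hΦt' hUc hUs hdivU hsup χ hχ hχ0
  have hVo : IsOpen (V : Set (ℝ × EuclideanSpace ℝ (Fin 3))) := V.isOpen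
  set K : Set (ℝ × EuclideanSpace ℝ (Fin 3)) := tsupport (uncurry χ) with hK
  have hKc : IsCompact K := hχ.hasCompactSupport
  have hKV : K ⊆ (V : Set (ℝ × EuclideanSpace ℝ (Fin 3))) := hχ.tsupport_subset
  have hχK : ∀ z : ℝ × EuclideanSpace ℝ (Fin 3), z ∉ K → χ z.1 z.2 = 0 := fun z hz =>
    (image_eq_zero_of_notMem_tsupport hz : uncurry χ z = 0)
  have hDχK : ∀ z : ℝ × EuclideanSpace ℝ (Fin 3), z ∉ K → fderiv ℝ (χ z.1) z.2 = 0 := fun z hz =>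
    fderiv_slice_eq_zero_of_notMem hz
  -- continuity on `V` of the classical quantities
  have cU : ContinuousOn (fun z : ℝ × EuclideanSpace ℝ (Fin 3) => U z.1 z.2) (V : Set (ℝ × EuclideanSpace ℝ (Fin 3))) := hUc
  have cΦ : ContinuousOn (fun z : ℝ × EuclideanSpace ℝ (Fin 3) => Φ z.1 z.2) (V : Set (ℝ × EuclideanSpace ℝ (Fin 3))) := hΦc
  have ceR : ContinuousOn (fun z : ℝ × EuclideanSpace ℝ (Fin 3) => eR z.2) (V : Set (ℝ × EuclideanSpace ℝ (Fin 3))) :=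
    continuousOn_eR_offAxis.comp continuous_snd.continuousOn fun z hz => hVρ z hz
  have cinv : ContinuousOn (fun z : ℝ × EuclideanSpace ℝ (Fin 3) => 2 / cylRadius z.2) (V : Set (ℝ × EuclideanSpace ℝ (Fin 3))) :=
    continuousOn_const.div (continuous_cylRadius.comp continuous_snd).continuousOn fun z hz => hVρ z hz
  have cDχ : Continuous fun z : ℝ × EuclideanSpace ℝ (Fin 3) => fderiv ℝ (χ z.1) z.2 := continuous_fderiv_slice hχ
  have cχ : Continuous fun z : ℝ × EuclideanSpace ℝ (Fin 3) => χ z.1 z.2 := hχ.contDiff.continuous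
  have cχt : Continuous fun z : ℝ × EuclideanSpace ℝ (Fin 3) => timeDeriv χ z.1 z.2 := hχ.continuous_timeDeriv
  -- the seven space–time integrands
  set Pt : ℝ × EuclideanSpace ℝ (Fin 3) → ℝ := fun z => χ z.1 z.2 * deriv (fun r => Φ r z.2) z.1 with hPt
  set PU : ℝ × EuclideanSpace ℝ (Fin 3) → ℝ := fun z => χ z.1 z.2 * fderiv ℝ (Φ z.1) z.2 (U z.1 z.2) with hPU
  set Pb : ℝ × EuclideanSpace ℝ (Fin 3) → ℝ := fun z =>
    χ z.1 z.2 * (2 / cylRadius z.2 * partialDeriv (eR z.2) (Φ z.1) z.2) with hPb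
  set PΔ : ℝ × EuclideanSpace ℝ (Fin 3) → ℝ := fun z => Laplacian.laplacian (Φ z.1) z.2 * χ z.1 z.2 with hPΔ
  set Qt : ℝ × EuclideanSpace ℝ (Fin 3) → ℝ := fun z => Φ z.1 z.2 * timeDeriv χ z.1 z.2 with hQt
  set QU : ℝ × EuclideanSpace ℝ (Fin 3) → ℝ := fun z => Φ z.1 z.2 * fderiv ℝ (χ z.1) z.2 (U z.1 z.2) with hQU
  set Qb : ℝ × EuclideanSpace ℝ (Fin 3) → ℝ := fun z =>
    Φ z.1 z.2 * (2 / cylRadius z.2 * partialDeriv (eR z.2) (χ z.1) z.2) with hQb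
  have iPt : Integrable Pt := integrable_of_continuousOn_of_eq_zero_off hVo hKc hKV
    (cχ.continuousOn.mul hΦt') (fun z hz => by simp [hPt, hχK z hz])
  have iPU : Integrable PU := integrable_of_continuousOn_of_eq_zero_off hVo hKc hKV
    (cχ.continuousOn.mul (hΦg.clm_apply cU)) (fun z hz => by simp [hPU, hχK z hz])
  have iPb : Integrable Pb := integrable_of_continuousOn_of_eq_zero_off hVo hKc hKV
    (cχ.continuousOn.mul (cinv.mul ((hΦg.clm_apply ceR).congr fun z _ => by simp only [partialDeriv_apply])))
    (fun z hz => by simp [hPb, hχK z hz])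
  have iPΔ : Integrable PΔ := integrable_of_continuousOn_of_eq_zero_off hVo hKc hKV
    (hΦΔ.mul cχ.continuousOn) (fun z hz => by simp [hPΔ, hχK z hz])
  have iQU : Integrable QU := integrable_of_continuousOn_of_eq_zero_off hVo hKc hKV
    (cΦ.mul (cDχ.continuousOn.clm_apply cU)) (fun z hz => by simp [hQU, hDχK z hz])
  have iQb : Integrable Qb := integrable_of_continuousOn_of_eq_zero_off hVo hKc hKV
    (cΦ.mul (cinv.mul ((cDχ.continuousOn.clm_apply ceR).congr fun z _ => by simp only [partialDeriv_apply])))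
    (fun z hz => by simp [hQb, partialDeriv_apply, hDχK z hz])
  -- (1) the pointwise inequality, integrated
  have h1 : 0 ≤ ∫ z, (Pt z + PU z + Pb z - PΔ z) := by
    refine integral_nonneg fun z => ?_
    by_cases hz : z ∈ (V : Set (ℝ × EuclideanSpace ℝ (Fin 3)))
    · have e : Pt z + PU z + Pb z - PΔ z = χ z.1 z.2 * (deriv (fun r => Φ r z.2) z.1 + fderiv ℝ (Φ z.1) z.2 (U z.1 z.2) +
          2 / cylRadius z.2 * partialDeriv (eR z.2) (Φ z.1) z.2 - Laplacian.laplacian (Φ z.1) z.2) := by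
        simp only [hPt, hPU, hPb, hPΔ]; ring
      rw [e]
      exact mul_nonneg (hχ0 _ _) (hsup z hz)
    · have hzK : z ∉ K := fun h => hz (hKV h)
      simp [hPt, hPU, hPb, hPΔ, hχK z hzK]
  have i12 : Integrable (fun z => Pt z + PU z) := iPt.add iPU
  have i123 : Integrable (fun z => Pt z + PU z + Pb z) := i12.add iPb
  have h1' : ∫ z, (Pt z + PU z + Pb z - PΔ z) = (∫ z, Pt z) + (∫ z, PU z) + (∫ z, Pb z) - ∫ z, PΔ z := by
    rw [integral_sub i123 iPΔ, integral_add i12 iPb, integral_add iPt iPU]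
  -- (2) the time derivative by parts
  have h2 : ∫ z, Pt z = -∫ z, Qt z := by
    have h := integral_mul_timeDeriv_slice_eq_neg (U := V) (g := fun z => Φ z.1 z.2) (χ := χ) cΦ hΦt hΦt' hχ
    have e1 : ∫ z, Qt z = ∫ z : ℝ × EuclideanSpace ℝ (Fin 3), Φ z.1 z.2 * timeDeriv χ z.1 z.2 := rfl
    have e2 : ∫ z, Pt z = ∫ z : ℝ × EuclideanSpace ℝ (Fin 3), deriv (fun s => Φ s z.2) z.1 * χ z.1 z.2 :=
      integral_congr_ae (Eventually.of_forall fun z => mul_comm _ _)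
    rw [e1, e2, h, neg_neg]
  -- (3) the drift `U` by parts in space, slice by slice
  have h3 : ∫ z, PU z = -∫ z, QU z := by
    have hsum : ∫ z, (PU z + QU z) = 0 := by
      refine integral_eq_zero_of_forall_slice (iPU.add iQU) fun t => ?_
      set O : Set (EuclideanSpace ℝ (Fin 3)) := {x | (t, x) ∈ (V : Set (ℝ × EuclideanSpace ℝ (Fin 3)))} with hO
      have hmk : Continuous fun x : EuclideanSpace ℝ (Fin 3) => ((t, x) : ℝ × EuclideanSpace ℝ (Fin 3)) := continuous_const.prodMk continuous_id
      have hOo : IsOpen O := hVo.preimage hmk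
      have hF : ContDiffOn ℝ 1 (Φ t) O := fun x hx => ((hΦs (t, x) hx).of_le one_le_two).contDiffWithinAt
      have hX : ContDiffOn ℝ 1 (U t) O := fun x hx => (hUs (t, x) hx).contDiffWithinAt
      have hdiv : ∀ x ∈ O, VectorCalculus.divergence (U t) x = 0 := fun x hx => hdivU (t, x) hx
      have hθ : ContDiff ℝ 1 (χ t) := (hχ.contDiff_slice t).of_le (by norm_cast)
      have hθc : HasCompactSupport (χ t) := hχ.hasCompactSupport_slice t
      have hθO : tsupport (χ t) ⊆ O := fun x hx => by
        by_contra h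
        exact (notMem_tsupport_slice_of_notMem (fun h' => h (hKV h'))) hx
      have h := integral_mul_fderiv_add_mul_fderiv_eq_zero hOo hF hX hdiv hθ hθc hθO
      simpa [hPU, hQU] using h
    rw [integral_add iPU iQU] at hsum
    linarith
  -- (4) the singular drift `(2/ϱ) e_ϱ` by parts in space, slice by slice
  have h4 : ∫ z, Pb z = -∫ z, Qb z := by
    have hsum : ∫ z, (Pb z + Qb z) = 0 := by
      refine integral_eq_zero_of_forall_slice (iPb.add iQb) fun t => ?_
      set O : Set (EuclideanSpace ℝ (Fin 3)) := {x | (t, x) ∈ (V : Set (ℝ × EuclideanSpace ℝ (Fin 3)))} with hO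
      have hmk : Continuous fun x : EuclideanSpace ℝ (Fin 3) => ((t, x) : ℝ × EuclideanSpace ℝ (Fin 3)) := continuous_const.prodMk continuous_id
      have hOo : IsOpen O := hVo.preimage hmk
      have hOρ : ∀ x ∈ O, cylRadius x ≠ 0 := fun x hx => hVρ (t, x) hx
      have hF : ContDiffOn ℝ 1 (Φ t) O := fun x hx => ((hΦs (t, x) hx).of_le one_le_two).contDiffWithinAt
      have hX : ContDiffOn ℝ 1 (fun y : EuclideanSpace ℝ (Fin 3) => (2 / cylRadius y) • eR y) O :=
        fun x hx => (contDiffAt_axisDrift (hOρ x hx)).contDiffWithinAt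
      have hdiv : ∀ x ∈ O, VectorCalculus.divergence (fun y : EuclideanSpace ℝ (Fin 3) => (2 / cylRadius y) • eR y) x = 0 :=
        fun x hx => divergence_axisDrift_eq_zero (hOρ x hx)
      have hθ : ContDiff ℝ 1 (χ t) := (hχ.contDiff_slice t).of_le (by norm_cast)
      have hθc : HasCompactSupport (χ t) := hχ.hasCompactSupport_slice t
      have hθO : tsupport (χ t) ⊆ O := fun x hx => by
        by_contra h
        exact (notMem_tsupport_slice_of_notMem (fun h' => h (hKV h'))) hx
      have h := integral_mul_fderiv_add_mul_fderiv_eq_zero hOo hF hX hdiv hθ hθc hθO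
      simp only [map_smul, smul_eq_mul] at h
      have e : ∀ x, Pb (t, x) + Qb (t, x) = χ t x * (2 / cylRadius x * fderiv ℝ (Φ t) x (eR x)) +
          Φ t x * (2 / cylRadius x * fderiv ℝ (χ t) x (eR x)) := fun x => by
        simp only [hPb, hQb, partialDeriv_apply]
      simp_rw [e]
      exact h
    rw [integral_add iPb iQb] at hsum
    linarith
  -- assemble
  have e : -(∫ z, Qt z) - (∫ z, QU z) - (∫ z, Qb z) - (∫ z, PΔ z) = ∫ z, (Pt z + PU z + Pb z - PΔ z) := by
    rw [h1', h2, h3, h4]; ring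
  have goal : 0 ≤ -(∫ z, Qt z) - (∫ z, QU z) - (∫ z, Qb z) - ∫ z, PΔ z := by rw [e]; exact h1
  exact goal

end Summit.NavierStokesRegularity.NavierStokesRegularity.Theorems.AxisymmetricKatoGlobal.EulerScaling

end
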